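import Summits.KontsevichZagierPeriods.KontsevichZagierPeriods.Theses.ComplexOrientations
import Summits.KontsevichZagierPeriods.KontsevichZagierPeriods.Theorems.SymplecticScissorsPlanarTransport
import Summits.KontsevichZagierPeriods.KontsevichZagierPeriods.Theorems.ComplexOrientationsOrientationKernelSectorReductionNecessity

/-!
# `TypeOneIdentities` (stmt-KontsevichZagierPeriods-11368, route ComplexOrientations) — line `birth`,
lead c19 skeleton (RESHAPED 2026-08-17: the crux closes modulo ONE cite-only published theorem)

The crux (rank 2, ENGINE of the route): on a smooth, geometrically irreducible, DIVIDING real affine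
plane curve `{p = 0}`, `p ∈ ℚ[x,y]`, with compact real locus, every TRUE unit-sign identity
`Σ η_i Area(R_i) = Area(disc of radius √β)` among the areas of the oval interiors `R_i` is a chain of
Kontsevich–Zagier moves: `Σ η_i [s_i] − [e] ∈ KZ.relations`.

## Registered composition (`TypeOneIdentities_of`)

`TypeOneIdentities` is an instance of Conjecture 1 restricted to PLANAR integrand-`1` representations:
its combination `Σ η_i [s_i] − [e]` lies in the 1-period sector (oval interiors of a compact curve and the
disc are bounded — `isBounded_setOf_isBounded_connectedComponentIn_compl`, `isBounded_disc`, landed for the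
sibling crux `OrientationKernel`), its value vanishes by hypothesis, and vanishing sector elements are
relations as soon as equal-area bounded planar integrand-`1` representations are KZ-equivalent
(`sector_mem_relations_of_boundedPlanarKernel`, landed). That planar kernel is item stmt-4990
`SymplecticScissors.PlanarAreas`, which the tree PROVES modulo the single cite-only named fact
`Literature.NumberTheory.Transcendental.HuberWustholzCurvePeriods` (Huber–Wüstholz 2022, Thm. 13.3 (2))
— `SymplecticScissors.PlanarTransport.planarAreas_of_huberWustholzCurvePeriods`
(Theorems/SymplecticScissorsPlanarTransport.lean); the composite `HuberWustholzCurvePeriods → TypeOneIdentities` is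
LANDED as the conditional result `TypeOneIdentities.typeOneIdentities_of_huberWustholzCurvePeriods` (p150496,
Theorems/ComplexOrientationsTypeOneIdentitiesPlanarKernelGlue.lean, axioms propext/Classical.choice/Quot.sound).
Hence the registered composition has ONE load-bearing stub:

* `stub_huberWustholzCurvePeriods` (HW, LITERATURE DEBT — a published theorem, not a conjecture):
  `HuberWustholzCurvePeriods` (all ℚ̄-linear relations among periods of curve type are ℚ̄-combinations
  of the elementary relations (R1)–(R5); Literature/NumberTheory/Transcendental/CurvePeriods.lean:412).
  No `_holds` exists in the tree; discharging it means formalising Huber–Wüstholz's Part IV (analytic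
  subgroup theorem for 1-motives). The same literature-debt stub closes the lines of the cruxes
  `RealArcKernel` and `PlanarK0Injective` of route SymplecticScissors.

`TypeOneIdentities_of : TypeOneIdentities := typeOneIdentities_of_huberWustholzCurvePeriods stub_huberWustholzCurvePeriods`
(axioms of the composition: propext, Classical.choice, Quot.sound — checked).

## The HW-free Rokhlin-anchor form (kept, second composition `typeOneIdentities_of_anchor`)

The route's own mechanism (Rokhlin's complex orientations integrated, as a CHAIN) is kept as the
hypotheses-form composition `typeOneIdentities_compose : E → D → V → X → T2 → TypeOneIdentities` of leads
c3–c18, whose bookkeeping stubs are ALL LANDED by c19 — D = `TypeOneIdentities.stub_carrierDiscCalibration` (p149824),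
V = `TypeOneIdentities.stub_discRepValue` (p146062), X = `TypeOneIdentities.stub_discRepExists` (p150086), files
Theorems/ComplexOrientationsTypeOneIdentitiesStub*.lean — and enter `typeOneIdentities_of_anchor` as hypotheses
`hD hV hX` (to be replaced by the landed declarations once the farm has built those modules; they are not stubs).
Open on this side: E = `stub_rokhlinCarrierChain` (registered stub, XL: Green per cell, Stokes for
`Re/Im(x dy)` across the half `H₊`, `CauchyMove` at the poles; tree value proof
`rokhlin_sum_sign_mul_area_ovalInterior_mem_algebraic_mul_pi_holds`) and the completeness core T2
(`transportCore`, NOT registered any more: it is a weakening of the crux itself — conjecture-grade for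
symmetric / CM dividing curves, e.g. the D₄-symmetric M-quartic `(x²+4y²−4)(4x²+y²−4)+ε` carries four
true unit identities `≠ ±η₀` — and is implied by HW through `TypeOneIdentities_of`; it enters
`typeOneIdentities_of_anchor` as an explicit hypothesis).
-/

noncomputable section

namespace Summit.KontsevichZagierPeriods.ComplexOrientations.TypeOneIdentities.Birth

open Summit.KontsevichZagierPeriods.KontsevichZagierPeriods.Theses.ComplexOrientations (TypeOneIdentities)
open Summit.KontsevichZagierPeriods.KontsevichZagierPeriods.Theses.SymplecticScissors (PlanarAreas)
open Summit.KontsevichZagierPeriods.ComplexOrientations.OrientationKernel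
open Literature.NumberTheory.Transcendental

/-! ### The registered stubs -/

/-- **Stub HW — `huberWustholzCurvePeriods` (LITERATURE DEBT).** Huber–Wüstholz 2022, Thm. 13.3 (2)
(= Thm. 1.2, Kontsevich's period conjecture for periods of curve type): every ℚ̄-linear relation among
periods `∫_γ ω` of curve type is a ℚ̄-combination of the elementary relations (R1)–(R5) — the tree's
cite-only named fact `Literature.NumberTheory.Transcendental.HuberWustholzCurvePeriods`
(CurvePeriods.lean:412), verbatim. Discharging this stub = proving `HuberWustholzCurvePeriods_holds`.
[HuberWustholz2022, Thm. 13.3 (2)] -/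
theorem stub_huberWustholzCurvePeriods : Literature.NumberTheory.Transcendental.HuberWustholzCurvePeriods := by
  sorry

/-- **Stub E — `rokhlinCarrierChain` (ENGINE, XL; Rokhlin's complex orientations integrated, as a
chain).** For a smooth, geometrically irreducible, dividing real affine plane curve over `ℚ` with
compact real locus, ovals `O_i` with integrand-1 representations `s_i` over their interiors: there
are unit signs `η` and a real algebraic `a` with `Σ η_i [s_i] − [ℝ, a/(1+s²)] ∈ KZ.relations`
(Green per CAD cell of each interior; Stokes for the closed semialgebraic 1-forms `Re/Im (x dy)|_X`
over the `ℚ`-semialgebraic bordered surface `H̄₊` minus pole discs, cut into bands with the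
coordinate functions as primitives; `CauchyMove` (item 11370, proved) at each pole of `x dy` in `H₊`;
rule 1b to merge the carriers). [Rokhlin1974, DegtyarevKharlamov2000 §1, Gustafsson1983,
KontsevichZagier2001 §1.2] -/
theorem stub_rokhlinCarrierChain :
    ∀ (p : MvPolynomial (Fin 2) ℚ), IsCompact {v : Fin 2 → ℝ | MvPolynomial.aeval v p = 0} → (∀ w : Fin 2 → ℂ, MvPolynomial.aeval w p = 0 → ∃ i, MvPolynomial.aeval w (MvPolynomial.pderiv i p) ≠ 0) → Irreducible (MvPolynomial.map (algebraMap ℚ ℂ) p) → ¬ IsPreconnected {w : Fin 2 → ℂ | MvPolynomial.aeval w p = 0 ∧ ∃ i, (w i).im ≠ 0} → ∀ (k : ℕ) (O : Fin k → Set (Fin 2 → ℝ)) (s : Fin k → Literature.NumberTheory.Transcendental.KZ.IntegralRep 2), (∀ i, ∃ v : Fin 2 → ℝ, MvPolynomial.aeval v p = 0 ∧ O i = connectedComponentIn {u : Fin 2 → ℝ | MvPolynomial.aeval u p = 0} v) → Function.Injective O → (∀ v : Fin 2 → ℝ, MvPolynomial.aeval v p = 0 → ∃ i, v ∈ O i)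 → (∀ i, (s i).domain = {v : Fin 2 → ℝ | v ∉ O i ∧ Bornology.IsBounded (connectedComponentIn (O i)ᶜ v)}) → (∀ i, ∀ v ∈ (s i).domain, (s i).integrand v = 1) → ∃ (η : Fin k → ℤ) (a : ℝ) (r : Literature.NumberTheory.Transcendental.KZ.IntegralRep 1), (∀ i, η i = 1 ∨ η i = -1) ∧ IsAlgebraic ℚ a ∧ r.domain = Set.univ ∧ (∀ z : Fin 1 → ℝ, r.integrand z = a / (1 + (z 0) ^ 2)) ∧ (∑ i, η i • Literature.NumberTheory.Transcendental.KZ.of (s i)) - Literature.NumberTheory.Transcendental.KZ.of r ∈ Literature.NumberTheory.Transcendental.KZ.relations := by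
  sorry

/-! ### Glue: the crux sits inside the planar kernel (all sorry-free; LANDED verbatim as
`Summit.KontsevichZagierPeriods.ComplexOrientations.TypeOneIdentities.*` in
Theorems/ComplexOrientationsTypeOneIdentitiesPlanarKernelGlue.lean, p150496 — restated here under `.Birth` only so that
this workfile elaborates while the farm builds the new module; the hypotheses-form results are `def`s because the
skeleton audit admits only the registered stubs as hypotheses of crux-concluding theorems) -/

/-- **The crux's combination lies in the 1-period sector.** For a real plane curve with compact real
locus, ovals `Oᵢ`, integrand-`1` representations `sᵢ` over their interiors and a `π`-carrier `e`, the
combination `Σ nᵢ • [sᵢ] − [e]` lies in the subgroup generated by the classes of bounded planar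
integrand-`1` representations (hence in the 1-period sector `S`). [folklore] -/
theorem ovalCombination_mem_sector
    (p : MvPolynomial (Fin 2) ℚ) (hp : IsCompact {v : Fin 2 → ℝ | MvPolynomial.aeval v p = 0})
    (k : ℕ) (O : Fin k → Set (Fin 2 → ℝ)) (s : Fin k → KZ.IntegralRep 2)
    (hO : ∀ i, ∃ v : Fin 2 → ℝ, MvPolynomial.aeval v p = 0 ∧
      O i = connectedComponentIn {u : Fin 2 → ℝ | MvPolynomial.aeval u p = 0} v)
    (hdom : ∀ i, (s i).domain =
      {v : Fin 2 → ℝ | v ∉ O i ∧ Bornology.IsBounded (connectedComponentIn (O i)ᶜ v)})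
    (hint : ∀ i, ∀ v ∈ (s i).domain, (s i).integrand v = 1)
    (n : Fin k → ℤ) (β : ℝ) (e : KZ.IntegralRep 2)
    (he : e.domain = {v : Fin 2 → ℝ | v 0 ^ 2 + v 1 ^ 2 < β}) (heint : ∀ v ∈ e.domain, e.integrand v = 1) :
    (∑ i, n i • KZ.of (s i)) - KZ.of e ∈ AddSubgroup.closure ({c : KZ.FormalRep | ∃ s :
      KZ.IntegralRep 0, c = KZ.of s} ∪ {c : KZ.FormalRep | ∃ s : KZ.IntegralRep 1, c = KZ.of s} ∪ {c
      : KZ.FormalRep | ∃ s : KZ.IntegralRep 2, Bornology.IsBounded s.domain ∧ (∀ v ∈ s.domain,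
      s.integrand v = 1) ∧ c = KZ.of s}) := by
  set S : AddSubgroup KZ.FormalRep := AddSubgroup.closure
    ({c : KZ.FormalRep | ∃ s : KZ.IntegralRep 0, c = KZ.of s} ∪
      {c : KZ.FormalRep | ∃ s : KZ.IntegralRep 1, c = KZ.of s} ∪
      {c : KZ.FormalRep | ∃ s : KZ.IntegralRep 2, Bornology.IsBounded s.domain ∧
        (∀ v ∈ s.domain, s.integrand v = 1) ∧ c = KZ.of s}) with hS_def
  have planar_mem : ∀ s : KZ.IntegralRep 2, Bornology.IsBounded s.domain →
      (∀ v ∈ s.domain, s.integrand v = 1) → KZ.of s ∈ S :=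
    fun s hb h1 => AddSubgroup.subset_closure (Or.inr ⟨s, hb, h1, rfl⟩)
  refine S.sub_mem (S.sum_mem fun i _ => S.zsmul_mem (planar_mem _ ?_ (hint i)) _)
    (planar_mem _ ?_ heint)
  · obtain ⟨v, -, hOi⟩ := hO i
    rw [hdom i]
    exact isBounded_setOf_isBounded_connectedComponentIn_compl hp (hOi ▸ connectedComponentIn_subset _ _)
  · rw [he]
    exact isBounded_disc β

set_option linter.defProp false in
/-- **The bounded planar kernel implies the crux `TypeOneIdentities`.** If any two bounded planar
integrand-`1` representations of equal area are congruent modulo the moves of the Kontsevich–Zagier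
calculus, then every true unit-sign oval-area identity of a dividing curve against a `π`-disc is a chain:
the combination lies in the 1-period sector (`ovalCombination_mem_sector`), its value is `0` by the
hypothesis `Σ ηᵢ value(sᵢ) = value(e)`, and vanishing sector elements are relations
(`sector_mem_relations_of_boundedPlanarKernel`). [Kontsevich–Zagier 2001, §1.2; folklore] -/
def typeOneIdentities_of_boundedPlanarKernel
    (h : ∀ A B : KZ.IntegralRep 2, Bornology.IsBounded A.domain → Bornology.IsBounded B.domain →
      (∀ v ∈ A.domain, A.integrand v = 1) → (∀ v ∈ B.domain, B.integrand v = 1) →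
      A.value = B.value → KZ.of A - KZ.of B ∈ KZ.relations) :
    TypeOneIdentities := by
  intro p hcpt _ _ _ k O s hO _ _ hdom hone η β e _ _ _ hed hei hval
  refine sector_mem_relations_of_boundedPlanarKernel h _
    (ovalCombination_mem_sector p hcpt k O s hO hdom hone η β e hed hei) ?_
  simp only [map_sub, map_sum, map_zsmul, KZ.eval_of, zsmul_eq_mul, hval, sub_self]

set_option linter.defProp false in
/-- **`PlanarAreas → TypeOneIdentities`** (the route's KILL CRITERIA clause, by name): the planar kernel
item stmt-KontsevichZagierPeriods-4990 of route `SymplecticScissors` gives the bounded planar kernel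
(`boundedPlanarKernel_of_planarAreas`), hence the crux. [folklore] -/
def typeOneIdentities_of_planarAreas (h : PlanarAreas) : TypeOneIdentities :=
  typeOneIdentities_of_boundedPlanarKernel (boundedPlanarKernel_of_planarAreas h)

set_option linter.defProp false in
/-- **`TypeOneIdentities` modulo Huber–Wüstholz (conditional result).** The cite-only named fact
`HuberWustholzCurvePeriods` (Huber–Wüstholz 2022, Thm. 13.3 (2), the period conjecture for periods of curve
type) implies the crux: it gives `PlanarAreas` (landed, `planarAreas_of_huberWustholzCurvePeriods`: every
ℚ̄-linear relation among real 1-periods is a chain of real semialgebraic moves, hence equal-area planar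
ℚ-regions are KZ-equivalent), and `PlanarAreas → TypeOneIdentities` is `typeOneIdentities_of_planarAreas`.
[cite: HuberWustholz2022, Thm. 13.3 (2)] -/
def typeOneIdentities_of_huberWustholzCurvePeriods (hHW : HuberWustholzCurvePeriods) : TypeOneIdentities :=
  typeOneIdentities_of_planarAreas
    (Summit.KontsevichZagierPeriods.SymplecticScissors.PlanarTransport.planarAreas_of_huberWustholzCurvePeriods hHW)

/-- **Skeleton theorem (registered form).** The crux `TypeOneIdentities` BY NAME from the single
literature-debt stub `stub_huberWustholzCurvePeriods`, via the sorry-free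
`typeOneIdentities_of_huberWustholzCurvePeriods`; `sorry` occurs only inside the stubs. -/
theorem TypeOneIdentities_of : TypeOneIdentities :=
  typeOneIdentities_of_huberWustholzCurvePeriods stub_huberWustholzCurvePeriods

/-! ### The HW-free Rokhlin-anchor form (second composition) -/

/-- A representation with EMPTY domain is a relation: rule 1a with `σ = ∅ = ∅ ∪ ∅` (null overlap)
gives `[e] − [e] − [e] ∈ KZ.relations`. [KontsevichZagier2001 §1.2 rule (1)] -/
theorem of_mem_relations_of_domain_eq_empty {n : ℕ} (e : KZ.IntegralRep n) (he : e.domain = ∅) :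
    KZ.of e ∈ KZ.relations := by
  have hmem : KZ.of e - KZ.of e - KZ.of e ∈ KZ.relations := by
    refine KZ.domainAddRel_subset_relations ⟨n, e, e, e, ?_, ?_, fun _ _ => rfl, fun _ _ => rfl, rfl⟩
    · rw [Set.union_self]
    · rw [he, Set.empty_inter, MeasureTheory.measure_empty]
  have : KZ.of e - KZ.of e - KZ.of e = -KZ.of e := by abel
  rw [this] at hmem
  exact neg_mem_iff.mp hmem

/-- Evaluation of the crux's formal combination: `eval (Σ η_i [s_i] − [e]) = Σ η_i·value(s_i) − value(e)`.
[KontsevichZagier2001 §1.2] -/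
theorem eval_sum_zsmul_of_sub_of {k : ℕ} (η : Fin k → ℤ) (s : Fin k → KZ.IntegralRep 2)
    (e : KZ.IntegralRep 2) :
    KZ.eval ((∑ i, η i • KZ.of (s i)) - KZ.of e) = (∑ i, (η i : ℝ) * (s i).value) - e.value := by
  simp only [map_sub, map_sum, map_zsmul, KZ.eval_of, zsmul_eq_mul]

/-- Soundness read on the crux's combination: a chain forces the value identity
`Σ η_i·value(s_i) = value(e)`. [KontsevichZagier2001 §1.2] -/
theorem sum_mul_value_eq_of_mem_relations {k : ℕ} (η : Fin k → ℤ) (s : Fin k → KZ.IntegralRep 2)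
    (e : KZ.IntegralRep 2) (h : (∑ i, η i • KZ.of (s i)) - KZ.of e ∈ KZ.relations) :
    (∑ i, (η i : ℝ) * (s i).value) = e.value := by
  have h0 := KZ.relations_le_ker_eval_holds h
  rw [AddMonoidHom.mem_ker, eval_sum_zsmul_of_sub_of] at h0
  linarith

set_option linter.defProp false in
/-- **Composition (hypotheses form, pure logic + soundness).** The five stub STATEMENTS imply the crux
BY NAME: E gives `(η_E, a, r)`, D turns `ε·[r]` into every integrand-1 disc of radius `√β_D`, so
`(ε·η_E, β_D)` is an anchor with chain `ε·(E-chain) + (D-chain)`; by X, V and soundness its value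
identity is `Σ (εη_E)_i Area(R_i) = π β_D`; a true identity with the same sign vector has `β = β_D` and
the anchor applies to `e` itself; the opposite sign vector forces `β = β_D = 0` and empty discs are
relations; every other sign vector is T2.  Declared as a `def` so that the registered skeleton theorem
below is the unique theorem concluding the crux. -/
def typeOneIdentities_compose
    (hE : ∀ (p : MvPolynomial (Fin 2) ℚ), IsCompact {v : Fin 2 → ℝ | MvPolynomial.aeval v p = 0} → (∀ w : Fin 2 → ℂ, MvPolynomial.aeval w p = 0 → ∃ i, MvPolynomial.aeval w (MvPolynomial.pderiv i p) ≠ 0) → Irreducible (MvPolynomial.map (algebraMap ℚ ℂ) p) → ¬ IsPreconnected {w : Fin 2 → ℂ | MvPolynomial.aeval w p = 0 ∧ ∃ i, (w i).im ≠ 0} → ∀ (k : ℕ) (O : Fin k → Set (Fin 2 → ℝ)) (s : Fin k → Literature.NumberTheory.Transcendental.KZ.IntegralRep 2), (∀ i, ∃ v : Fin 2 → ℝ, MvPolynomial.aeval v p = 0 ∧ O i = connectedComponentIn {u : Fin 2 → ℝ | MvPolynomial.aeval u p = 0} v) → Function.Injective O → (∀ v : Fin 2 → ℝ, MvPolynomial.aeval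 v p = 0 → ∃ i, v ∈ O i) → (∀ i, (s i).domain = {v : Fin 2 → ℝ | v ∉ O i ∧ Bornology.IsBounded (connectedComponentIn (O i)ᶜ v)}) → (∀ i, ∀ v ∈ (s i).domain, (s i).integrand v = 1) → ∃ (η : Fin k → ℤ) (a : ℝ) (r : Literature.NumberTheory.Transcendental.KZ.IntegralRep 1), (∀ i, η i = 1 ∨ η i = -1) ∧ IsAlgebraic ℚ a ∧ r.domain = Set.univ ∧ (∀ z : Fin 1 → ℝ, r.integrand z = a / (1 + (z 0) ^ 2)) ∧ (∑ i, η i • Literature.NumberTheory.Transcendental.KZ.of (s i)) - Literature.NumberTheory.Transcendental.KZ.of r ∈ Literature.NumberTheory.Transcendental.KZ.relations)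
    (hD : ∀ (a : ℝ) (r : Literature.NumberTheory.Transcendental.KZ.IntegralRep 1), IsAlgebraic ℚ a → r.domain = Set.univ → (∀ z : Fin 1 → ℝ, r.integrand z = a / (1 + (z 0) ^ 2)) → ∃ (ε : ℤ) (β : ℝ), (ε = 1 ∨ ε = -1) ∧ IsAlgebraic ℚ β ∧ 0 ≤ β ∧ ∀ e : Literature.NumberTheory.Transcendental.KZ.IntegralRep 2, e.domain = {v : Fin 2 → ℝ | v 0 ^ 2 + v 1 ^ 2 < β} → (∀ v ∈ e.domain, e.integrand v = 1) → ε • Literature.NumberTheory.Transcendental.KZ.of r - Literature.NumberTheory.Transcendental.KZ.of e ∈ Literature.NumberTheory.Transcendental.KZ.relations)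
    (hV : ∀ (β : ℝ) (e : Literature.NumberTheory.Transcendental.KZ.IntegralRep 2), 0 ≤ β → e.domain = {v : Fin 2 → ℝ | v 0 ^ 2 + v 1 ^ 2 < β} → (∀ v ∈ e.domain, e.integrand v = 1) → e.value = Real.pi * β)
    (hX : ∀ β : ℝ, IsAlgebraic ℚ β → ∃ e : Literature.NumberTheory.Transcendental.KZ.IntegralRep 2, e.domain = {v : Fin 2 → ℝ | v 0 ^ 2 + v 1 ^ 2 < β} ∧ ∀ v ∈ e.domain, e.integrand v = 1)
    (hT : ∀ (p : MvPolynomial (Fin 2) ℚ), IsCompact {v : Fin 2 → ℝ | MvPolynomial.aeval v p = 0} → (∀ w : Fin 2 → ℂ, MvPolynomial.aeval w p = 0 → ∃ i, MvPolynomial.aeval w (MvPolynomial.pderiv i p) ≠ 0) → Irreducible (MvPolynomial.map (algebraMap ℚ ℂ) p) → ¬ IsPreconnected {w : Fin 2 → ℂ | MvPolynomial.aeval w p = 0 ∧ ∃ i, (w i).im ≠ 0} → ∀ (k : ℕ) (O : Fin k → Set (Fin 2 → ℝ)) (s : Fin k → Literature.NumberTheory.Transcendental.KZ.IntegralRep 2),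 (∀ i, ∃ v : Fin 2 → ℝ, MvPolynomial.aeval v p = 0 ∧ O i = connectedComponentIn {u : Fin 2 → ℝ | MvPolynomial.aeval u p = 0} v) → Function.Injective O → (∀ v : Fin 2 → ℝ, MvPolynomial.aeval v p = 0 → ∃ i, v ∈ O i) → (∀ i, (s i).domain = {v : Fin 2 → ℝ | v ∉ O i ∧ Bornology.IsBounded (connectedComponentIn (O i)ᶜ v)}) → (∀ i, ∀ v ∈ (s i).domain, (s i).integrand v = 1) → ∀ (η₀ : Fin k → ℤ) (β₀ : ℝ), (∀ i, η₀ i = 1 ∨ η₀ i = -1) → IsAlgebraic ℚ β₀ → 0 ≤ β₀ → (∀ e₀ : Literature.NumberTheory.Transcendental.KZ.IntegralRep 2, e₀.domain = {v : Fin 2 → ℝ | v 0 ^ 2 + v 1 ^ 2 < β₀} → (∀ v ∈ e₀.domain, e₀.integrand v = 1) → (∑ i, η₀ i • Literature.NumberTheory.Transcendental.KZ.of (s i)) - Literature.NumberTheory.Transcendental.KZ.of e₀ ∈ Literature.NumberTheory.Transcendental.KZ.relations) → ∀ (η : Fin k → ℤ) (β : ℝ) (e : Literature.NumberTheory.Transcendental.KZ.IntegralRep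 2), (∀ i, η i = 1 ∨ η i = -1) → IsAlgebraic ℚ β → 0 ≤ β → e.domain = {v : Fin 2 → ℝ | v 0 ^ 2 + v 1 ^ 2 < β} → (∀ v ∈ e.domain, e.integrand v = 1) → ∑ i, (η i : ℝ) * (s i).value = e.value → η ≠ η₀ → η ≠ -η₀ → (∑ i, η i • Literature.NumberTheory.Transcendental.KZ.of (s i)) - Literature.NumberTheory.Transcendental.KZ.of e ∈ Literature.NumberTheory.Transcendental.KZ.relations) :
    TypeOneIdentities := by
  intro p hcpt hsm hirr hdiv k O s hO hinj hcov hdom hone η β e hη hβ hβ0 hed hei hval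
  obtain ⟨η₁, a, r, hη₁, ha, hrd, hri, hchain⟩ :=
    hE p hcpt hsm hirr hdiv k O s hO hinj hcov hdom hone
  obtain ⟨ε, β₀, hε, hβ₀, hβ₀0, hcal⟩ := hD a r ha hrd hri
  -- the anchor `(η₀, β₀)`, `η₀ = ε·η₁`
  set η₀ : Fin k → ℤ := fun i => ε * η₁ i with hη₀_def
  have hη₀ : ∀ i, η₀ i = 1 ∨ η₀ i = -1 := by
    intro i
    rcases hε with h | h <;> rcases hη₁ i with h' | h' <;> simp [hη₀_def, h, h']
  have hanchor : ∀ e₀ : KZ.IntegralRep 2, e₀.domain = {v : Fin 2 → ℝ | v 0 ^ 2 + v 1 ^ 2 < β₀} →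
      (∀ v ∈ e₀.domain, e₀.integrand v = 1) →
      (∑ i, η₀ i • KZ.of (s i)) - KZ.of e₀ ∈ KZ.relations := by
    intro e₀ hd₀ hi₀
    have hsum : (∑ i, (ε * η₁ i) • KZ.of (s i)) = ε • ∑ i, η₁ i • KZ.of (s i) := by
      rw [Finset.smul_sum]
      exact Finset.sum_congr rfl fun i _ => (smul_smul ε (η₁ i) _).symm
    have hsplit : (∑ i, (ε * η₁ i) • KZ.of (s i)) - KZ.of e₀ =
        ε • ((∑ i, η₁ i • KZ.of (s i)) - KZ.of r) + (ε • KZ.of r - KZ.of e₀) := by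
      rw [hsum, smul_sub]
      abel
    show (∑ i, (ε * η₁ i) • KZ.of (s i)) - KZ.of e₀ ∈ KZ.relations
    rw [hsplit]
    exact KZ.relations.add_mem (KZ.relations.zsmul_mem hchain ε) (hcal e₀ hd₀ hi₀)
  -- values: the anchor identity and the given identity
  obtain ⟨e₀, he₀d, he₀i⟩ := hX β₀ hβ₀
  have hv₀ : (∑ i, (η₀ i : ℝ) * (s i).value) = Real.pi * β₀ :=
    (sum_mul_value_eq_of_mem_relations η₀ s e₀ (hanchor e₀ he₀d he₀i)).trans (hV β₀ e₀ hβ₀0 he₀d he₀i)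
  have hv : (∑ i, (η i : ℝ) * (s i).value) = Real.pi * β := hval.trans (hV β e hβ0 hed hei)
  by_cases h1 : η = η₀
  · -- same signs: `β = β₀`, the anchor applies to `e`
    subst h1
    have hββ : β = β₀ := by
      have h := hv.symm.trans hv₀
      exact mul_left_cancel₀ Real.pi_ne_zero h
    subst hββ
    exact hanchor e hed hei
  by_cases h2 : η = -η₀
  · -- opposite signs: `β = β₀ = 0`, empty discs
    have hneg : (∑ i, (η i : ℝ) * (s i).value) = -∑ i, (η₀ i : ℝ) * (s i).value := by
      rw [h2, ← Finset.sum_neg_distrib]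
      refine Finset.sum_congr rfl fun i _ => ?_
      simp only [Pi.neg_apply, Int.cast_neg, neg_mul]
    have hβsum : β + β₀ = 0 := by
      have h : Real.pi * β = -(Real.pi * β₀) := by rw [← hv, ← hv₀, hneg]
      have : Real.pi * (β + β₀) = 0 := by rw [mul_add, h]; ring
      rcases mul_eq_zero.mp this with hπ | h'
      · exact absurd hπ Real.pi_ne_zero
      · exact h'
    have hβz : β = 0 := le_antisymm (by linarith) hβ0
    have hβ₀z : β₀ = 0 := by linarith
    have hed₀ : e.domain = {v : Fin 2 → ℝ | v 0 ^ 2 + v 1 ^ 2 < β₀} := by rw [hed, hβz, hβ₀z]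
    have he_rel : KZ.of e ∈ KZ.relations := by
      refine of_mem_relations_of_domain_eq_empty e ?_
      rw [hed, hβz]
      ext v
      simp only [Set.mem_setOf_eq, Set.mem_empty_iff_false, iff_false, not_lt]
      positivity
    have hA := hanchor e hed₀ hei
    have hrew : (∑ i, η i • KZ.of (s i)) - KZ.of e =
        -((∑ i, η₀ i • KZ.of (s i)) - KZ.of e) - 2 • KZ.of e := by
      rw [h2]
      simp only [Pi.neg_apply, neg_smul, Finset.sum_neg_distrib]
      abel
    rw [hrew]
    exact KZ.relations.sub_mem (KZ.relations.neg_mem hA) (KZ.relations.nsmul_mem he_rel 2)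
  · exact hT p hcpt hsm hirr hdiv k O s hO hinj hcov hdom hone η₀ β₀ hη₀ hβ₀ hβ₀0 hanchor η β e hη hβ
      hβ0 hed hei hval h1 h2

set_option linter.defProp false in
/-- **The anchor composition.** Modulo the registered engine stub E (`stub_rokhlinCarrierChain`), GIVEN the landed
bookkeeping stubs D (`TypeOneIdentities.stub_carrierDiscCalibration`, p149824), V (`TypeOneIdentities.stub_discRepValue`,
p146062), X (`TypeOneIdentities.stub_discRepExists`, p150086) as hypotheses `hD hV hX` (their modules are new in the tree),
and GIVEN the completeness core T2 as the explicit hypothesis `hT` (conjecture-grade residual, implied by HW through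
`TypeOneIdentities_of`), the crux follows by `typeOneIdentities_compose`. [Rokhlin1974; KontsevichZagier2001 §1.2] -/
def typeOneIdentities_of_anchor
    (hD : ∀ (a : ℝ) (r : Literature.NumberTheory.Transcendental.KZ.IntegralRep 1), IsAlgebraic ℚ a → r.domain = Set.univ → (∀ z : Fin 1 → ℝ, r.integrand z = a / (1 + (z 0) ^ 2)) → ∃ (ε : ℤ) (β : ℝ), (ε = 1 ∨ ε = -1) ∧ IsAlgebraic ℚ β ∧ 0 ≤ β ∧ ∀ e : Literature.NumberTheory.Transcendental.KZ.IntegralRep 2, e.domain = {v : Fin 2 → ℝ | v 0 ^ 2 + v 1 ^ 2 < β} → (∀ v ∈ e.domain, e.integrand v = 1) → ε • Literature.NumberTheory.Transcendental.KZ.of r - Literature.NumberTheory.Transcendental.KZ.of e ∈ Literature.NumberTheory.Transcendental.KZ.relations)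
    (hV : ∀ (β : ℝ) (e : Literature.NumberTheory.Transcendental.KZ.IntegralRep 2), 0 ≤ β → e.domain = {v : Fin 2 → ℝ | v 0 ^ 2 + v 1 ^ 2 < β} → (∀ v ∈ e.domain, e.integrand v = 1) → e.value = Real.pi * β)
    (hX : ∀ β : ℝ, IsAlgebraic ℚ β → ∃ e : Literature.NumberTheory.Transcendental.KZ.IntegralRep 2, e.domain = {v : Fin 2 → ℝ | v 0 ^ 2 + v 1 ^ 2 < β} ∧ ∀ v ∈ e.domain, e.integrand v = 1)
    (hT : ∀ (p : MvPolynomial (Fin 2) ℚ), IsCompact {v : Fin 2 → ℝ | MvPolynomial.aeval v p = 0} → (∀ w : Fin 2 → ℂ, MvPolynomial.aeval w p = 0 → ∃ i, MvPolynomial.aeval w (MvPolynomial.pderiv i p) ≠ 0) → Irreducible (MvPolynomial.map (algebraMap ℚ ℂ) p) → ¬ IsPreconnected {w : Fin 2 → ℂ | MvPolynomial.aeval w p = 0 ∧ ∃ i, (w i).im ≠ 0} → ∀ (k : ℕ) (O : Fin k → Set (Fin 2 → ℝ)) (s : Fin k → Literature.NumberTheory.Transcendental.KZ.IntegralRep 2),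 (∀ i, ∃ v : Fin 2 → ℝ, MvPolynomial.aeval v p = 0 ∧ O i = connectedComponentIn {u : Fin 2 → ℝ | MvPolynomial.aeval u p = 0} v) → Function.Injective O → (∀ v : Fin 2 → ℝ, MvPolynomial.aeval v p = 0 → ∃ i, v ∈ O i) → (∀ i, (s i).domain = {v : Fin 2 → ℝ | v ∉ O i ∧ Bornology.IsBounded (connectedComponentIn (O i)ᶜ v)}) → (∀ i, ∀ v ∈ (s i).domain, (s i).integrand v = 1) → ∀ (η₀ : Fin k → ℤ) (β₀ : ℝ), (∀ i, η₀ i = 1 ∨ η₀ i = -1) → IsAlgebraic ℚ β₀ → 0 ≤ β₀ → (∀ e₀ : Literature.NumberTheory.Transcendental.KZ.IntegralRep 2, e₀.domain = {v : Fin 2 → ℝ | v 0 ^ 2 + v 1 ^ 2 < β₀} → (∀ v ∈ e₀.domain, e₀.integrand v = 1) → (∑ i, η₀ i • Literature.NumberTheory.Transcendental.KZ.of (s i)) - Literature.NumberTheory.Transcendental.KZ.of e₀ ∈ Literature.NumberTheory.Transcendental.KZ.relations) → ∀ (η : Fin k → ℤ) (β : ℝ) (e : Literature.NumberTheory.Transcendental.KZ.IntegralRep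 2), (∀ i, η i = 1 ∨ η i = -1) → IsAlgebraic ℚ β → 0 ≤ β → e.domain = {v : Fin 2 → ℝ | v 0 ^ 2 + v 1 ^ 2 < β} → (∀ v ∈ e.domain, e.integrand v = 1) → ∑ i, (η i : ℝ) * (s i).value = e.value → η ≠ η₀ → η ≠ -η₀ → (∑ i, η i • Literature.NumberTheory.Transcendental.KZ.of (s i)) - Literature.NumberTheory.Transcendental.KZ.of e ∈ Literature.NumberTheory.Transcendental.KZ.relations) :
    TypeOneIdentities :=
  typeOneIdentities_compose stub_rokhlinCarrierChain hD hV hX hT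

end Summit.KontsevichZagierPeriods.ComplexOrientations.TypeOneIdentities.Birth

end
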